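import Mathlib
import Literature.Analysis.ValidatedNumerics.WeightedEllOneFourierAlgebra
import HarnessLib

/-!
# Cosine-series coefficient balls ↦ pointwise `C⁰` and `C¹` envelopes (the value dictionary a route-A consumer applies)

LADDER-GRIDFUSION (fusion WATCH, F2 → F3 consumer contract; `pub/gridfusion/models/model-7/g11/F3-WATCH-NOTE-2.md` §1),
cell `gridfusion`, seat `gridfusion-model-7` (g11), 2026-08-28.  A MODEL-SIDE tool file, 0 kit; companion of
`Models/RouteAChartGlue.lean`.  The coefficient algebra is certnum's `Literature.Analysis.ValidatedNumerics.WeightedEllOne`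
(`wnorm ν a = Σ' |a_k| ν^k`, `Mem`, `cosEval a x = Σ' a_k cos(kx)`, `abs_cosEval_le : |cosEval a x| ≤ ‖a‖_ν`,
[cite: HungriaLessardMirelesJames2016, §2.1 (1.2)]); this file adds the two width transfers a CONSUMER of an enclosure
`‖a − ā‖_ν ≤ r` uses pointwise in `θ`:
* §1 `C⁰`: `cosEval_sub`, **`abs_cosEval_sub_le`** `|cosEval a θ − cosEval ā θ| ≤ r` (`ν ≥ 1`).
* §2 `C¹`: the termwise derivative `dcosEval a = Σ' −k a_k sin(k·)`; a DECAY CONSTANT `IsDerivWeight ν λ` (`k ≤ λν^k ∀ k`, the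
  dictionary factor `max_k kν^{−k} ≤ 1/(e ln ν)` of certnum F2-ROUTE-A §0) with a RATIONAL FINITE TEST `isDerivWeight_of_finite`
  (`ν > 1`, `N(ν − 1) ≥ 1`, check the modes `k ≤ N`; e.g. `ν = 13/10`, `N = 4`, `λ = 4·(10/13)⁴`); `hasDerivAt_cosEval`
  (termwise differentiation, Mathlib `hasDerivAt_tsum`); `abs_dcosEval_le : |dcosEval a θ| ≤ λ‖a‖_ν`; `dcosEval_sub`;
  **`abs_dcosEval_sub_le`** `|dcosEval a θ − dcosEval ā θ| ≤ λ·r` — the factor a `C¹` consumer (GGJ/Mercier surface averages,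
  which need `Ψ̃_θ`) pays per `θ`-derivative.
* §3 `C²`: `ddcosEval a = Σ' −k² a_k cos(k·)`, `IsDeriv2Weight ν λ₂` (`k² ≤ λ₂ν^k`) with the rational finite test
  `isDeriv2Weight_of_finite` (`ν > 1`, `(N+1)² ≤ νN²`, check `k ≤ N`; e.g. `ν = 13/10`, `N = 8`), `hasDerivAt_dcosEval`,
  `abs_ddcosEval_le`, **`abs_ddcosEval_sub_le`** `≤ λ₂·r` — the factor the `C²` consumers (curvature, local shear, ballooning
  coefficients) pay.
NOT HERE: sine series; mixed/higher derivatives; any instance or value.  Natural home once used by both cells: `Literature/Analysis/ValidatedNumerics/` next to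
`WeightedEllOneFourierAlgebra.lean` (certnum lean seat's area) — staged Summits-side as a consumer tool meanwhile.
MODELLED: nothing (pure analysis about coefficient sequences); no instance, no value, no stability word.
FILING LABEL (director-gridfusion g12, HOME INBOX 2026-08-28T17:37:53Z): consumer glue for certnum route-A objects (F3-WATCH-NOTE-2 §0–§1); WATCH lane, RULING 70 (7); no s–α content, no ★ row.
-/

noncomputable section

open Real Set
open Literature.Analysis.ValidatedNumerics.WeightedEllOne

namespace Summit.Ventures.FusionMHD.Models

namespace RouteA

/-! ## §1 The `C⁰` width transfer -/

section CZero

variable {ν : ℝ}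

/-- `cosEval` is additive on `ℓ¹_ν` (`ν ≥ 1`). [folklore] -/
theorem cosEval_sub (hν : 1 ≤ ν) {a b : ℕ → ℝ} (ha : Mem ν a) (hb : Mem ν b) (x : ℝ) :
    cosEval a x - cosEval b x = cosEval (a - b) x := by
  have hsa : Summable fun k => a k * Real.cos (k * x) :=
    Summable.of_norm_bounded (ha.summable_abs hν) fun k => by
      rw [Real.norm_eq_abs, abs_mul]; exact mul_le_of_le_one_right (abs_nonneg _) (Real.abs_cos_le_one _)
  have hsb : Summable fun k => b k * Real.cos (k * x) :=
    Summable.of_norm_bounded (hb.summable_abs hν) fun k => by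
      rw [Real.norm_eq_abs, abs_mul]; exact mul_le_of_le_one_right (abs_nonneg _) (Real.abs_cos_le_one _)
  unfold cosEval
  rw [← hsa.tsum_sub hsb]
  congr 1; funext k; simp only [Pi.sub_apply]; ring

/-- THE `C⁰` DICTIONARY for one coefficient function: `‖a − ā‖_ν ≤ r` (`ν ≥ 1`) ⇒ `|cosEval a θ − cosEval ā θ| ≤ r`
for every real `θ`. [cite: HungriaLessardMirelesJames2016, §2.1 (1.2)] -/
theorem abs_cosEval_sub_le (hν : 1 ≤ ν) {a abar : ℕ → ℝ} {r : ℝ} (ha : Mem ν a) (habar : Mem ν abar)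
    (hr : wnorm ν (a - abar) ≤ r) (θ : ℝ) : |cosEval a θ - cosEval abar θ| ≤ r := by
  rw [cosEval_sub hν ha habar]
  exact ((abs_cosEval_le hν (ha.sub (zero_le_one.trans hν) habar) θ).1).trans hr

end CZero

/-! ## §2 The `θ`-derivative (`C¹`) dictionary: `d/dθ cosEval a = dcosEval a`, `|dcosEval a| ≤ λ‖a‖_ν` whenever `k ≤ λν^k`,
and a RATIONAL finite test for the decay constant `λ` -/

section ThetaDerivative

variable {ν lam : ℝ}

/-- The termwise `θ`-derivative of a cosine series: `dcosEval a x = Σ' −k·a_k·sin(kx)`. [folklore] -/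
def dcosEval (a : ℕ → ℝ) (x : ℝ) : ℝ := ∑' k : ℕ, -((k : ℝ) * a k) * Real.sin (k * x)

/-- A DECAY CONSTANT for one `θ`-derivative at weight `ν`: `k ≤ λ·ν^k` for every mode `k` (the value dictionary's
`C¹` factor, e.g. `λ = max_k kν^{−k} ≤ 1/(e ln ν)`; certnum F2-ROUTE-A §0). [cite: HungriaLessardMirelesJames2016, §2.1 (1.2)] -/
def IsDerivWeight (ν lam : ℝ) : Prop := ∀ k : ℕ, (k : ℝ) ≤ lam * ν ^ k

/-- RATIONAL FINITE TEST for the decay constant: for `ν > 1`, if `N(ν − 1) ≥ 1` and `k ≤ λν^k` for the finitely many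
`k ≤ N`, then `k ≤ λν^k` for all `k` (induction: `(k+1)/k ≤ ν` once `k ≥ N`). [folklore] -/
theorem isDerivWeight_of_finite (hν : 1 < ν) {N : ℕ} (hN : 1 ≤ (N : ℝ) * (ν - 1))
    (hfin : ∀ k ≤ N, (k : ℝ) ≤ lam * ν ^ k) : IsDerivWeight ν lam := by
  intro k
  induction k with
  | zero => exact hfin 0 (Nat.zero_le _)
  | succ k ih =>
    by_cases hk : k + 1 ≤ N
    · exact hfin (k + 1) hk
    · have hkN : (N : ℝ) ≤ k := by exact_mod_cast (by omega : N ≤ k)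
      have hν0 : 0 < ν := lt_trans zero_lt_one hν
      -- (k+1) ≤ k·ν ≤ λ ν^k · ν
      have h1 : (k : ℝ) + 1 ≤ k * ν := by nlinarith
      have h2 : (k : ℝ) * ν ≤ lam * ν ^ k * ν := mul_le_mul_of_nonneg_right ih hν0.le
      calc ((k + 1 : ℕ) : ℝ) = (k : ℝ) + 1 := by push_cast; ring
        _ ≤ lam * ν ^ k * ν := h1.trans h2
        _ = lam * ν ^ (k + 1) := by ring

/-- A decay constant is nonnegative (take `k = 1`… in fact `k = 0` gives nothing; `k = 1` gives `1 ≤ λν`). [folklore] -/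
theorem IsDerivWeight.nonneg (hν : 0 < ν) (h : IsDerivWeight ν lam) : 0 ≤ lam := by
  have h1 := h 1
  simp only [Nat.cast_one, pow_one] at h1
  nlinarith

/-- Termwise differentiability: for `a ∈ ℓ¹_ν` with a decay constant `λ`, `θ ↦ cosEval a θ` has derivative
`dcosEval a θ` everywhere. [folklore] -/
theorem hasDerivAt_cosEval (hν : 1 ≤ ν) (hlam : IsDerivWeight ν lam) {a : ℕ → ℝ} (ha : Mem ν a) (x : ℝ) :
    HasDerivAt (cosEval a) (dcosEval a x) x := by
  have hu : Summable fun k => lam * (|a k| * ν ^ k) := ha.mul_left lam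
  have hg : ∀ (k : ℕ) (y : ℝ),
      HasDerivAt (fun y => a k * Real.cos (k * y)) (-((k : ℝ) * a k) * Real.sin (k * y)) y := by
    intro k y
    have h1 : HasDerivAt (fun y : ℝ => (k : ℝ) * y) (k : ℝ) y := by
      simpa using (hasDerivAt_id y).const_mul (k : ℝ)
    have h2 := (Real.hasDerivAt_cos ((k : ℝ) * y)).comp y h1
    have h3 := h2.const_mul (a k)
    have e : a k * (-Real.sin ((k : ℝ) * y) * (k : ℝ)) = -((k : ℝ) * a k) * Real.sin (k * y) := by ring
    rw [← e]
    exact h3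
  have hg' : ∀ (k : ℕ) (y : ℝ), ‖-((k : ℝ) * a k) * Real.sin (k * y)‖ ≤ lam * (|a k| * ν ^ k) := by
    intro k y
    rw [Real.norm_eq_abs, abs_mul, abs_neg, abs_mul, Nat.abs_cast]
    have hs := Real.abs_sin_le_one ((k : ℝ) * y)
    have hk := hlam k
    have hνk : 0 ≤ ν ^ k := pow_nonneg (zero_le_one.trans hν) k
    calc (k : ℝ) * |a k| * |Real.sin (k * y)| ≤ (k : ℝ) * |a k| * 1 := by
          exact mul_le_mul_of_nonneg_left hs (by positivity)
      _ ≤ lam * ν ^ k * |a k| * 1 := by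
          exact mul_le_mul_of_nonneg_right (mul_le_mul_of_nonneg_right hk (abs_nonneg _)) zero_le_one
      _ = lam * (|a k| * ν ^ k) := by ring
  have hg0 : Summable fun k => a k * Real.cos (k * x) :=
    Summable.of_norm_bounded (ha.summable_abs hν) fun k => by
      rw [Real.norm_eq_abs, abs_mul]; exact mul_le_of_le_one_right (abs_nonneg _) (Real.abs_cos_le_one _)
  have h := hasDerivAt_tsum hu hg hg' hg0 x
  have e1 : cosEval a = fun z => ∑' n : ℕ, a n * Real.cos (n * z) := rfl
  have e2 : dcosEval a x = ∑' n : ℕ, -((n : ℝ) * a n) * Real.sin (n * x) := rfl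
  rw [e1, e2]
  exact h

/-- THE `C¹` DICTIONARY: `|dcosEval a θ| ≤ λ‖a‖_ν`. [cite: HungriaLessardMirelesJames2016, §2.1 (1.2)] -/
theorem abs_dcosEval_le (hlam : IsDerivWeight ν lam) {a : ℕ → ℝ} (ha : Mem ν a) (x : ℝ) :
    |dcosEval a x| ≤ lam * wnorm ν a := by
  have hbd : ∀ k : ℕ, ‖-((k : ℝ) * a k) * Real.sin (k * x)‖ ≤ lam * (|a k| * ν ^ k) := by
    intro k
    rw [Real.norm_eq_abs, abs_mul, abs_neg, abs_mul, Nat.abs_cast]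
    have hs := Real.abs_sin_le_one ((k : ℝ) * x)
    have hk := hlam k
    calc (k : ℝ) * |a k| * |Real.sin (k * x)| ≤ (k : ℝ) * |a k| * 1 := by
          exact mul_le_mul_of_nonneg_left hs (by positivity)
      _ ≤ lam * ν ^ k * |a k| * 1 := by
          exact mul_le_mul_of_nonneg_right (mul_le_mul_of_nonneg_right hk (abs_nonneg _)) zero_le_one
      _ = lam * (|a k| * ν ^ k) := by ring
  have hsum : HasSum (fun k => lam * (|a k| * ν ^ k)) (lam * wnorm ν a) := (ha.hasSum).mul_left lam
  have h := tsum_of_norm_bounded hsum hbd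
  rw [Real.norm_eq_abs] at h
  have e2 : dcosEval a x = ∑' n : ℕ, -((n : ℝ) * a n) * Real.sin (n * x) := rfl
  rw [e2]
  exact h

/-- `dcosEval` is additive on `ℓ¹_ν` (given a decay constant, which makes the derivative series absolutely summable).
[folklore] -/
theorem dcosEval_sub (hlam : IsDerivWeight ν lam) {a b : ℕ → ℝ} (ha : Mem ν a) (hb : Mem ν b)
    (x : ℝ) : dcosEval a x - dcosEval b x = dcosEval (a - b) x := by
  have bound : ∀ (c : ℕ → ℝ), Mem ν c → Summable fun k : ℕ => -((k : ℝ) * c k) * Real.sin (k * x) := by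
    intro c hc
    refine Summable.of_norm_bounded (hc.mul_left lam) fun k => ?_
    rw [Real.norm_eq_abs, abs_mul, abs_neg, abs_mul, Nat.abs_cast]
    have hs := Real.abs_sin_le_one ((k : ℝ) * x)
    have hk := hlam k
    calc (k : ℝ) * |c k| * |Real.sin (k * x)| ≤ (k : ℝ) * |c k| * 1 := by
          exact mul_le_mul_of_nonneg_left hs (by positivity)
      _ ≤ lam * ν ^ k * |c k| * 1 := by
          exact mul_le_mul_of_nonneg_right (mul_le_mul_of_nonneg_right hk (abs_nonneg _)) zero_le_one
      _ = lam * (|c k| * ν ^ k) := by ring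
  unfold dcosEval
  rw [← (bound a ha).tsum_sub (bound b hb)]
  congr 1; funext k; simp only [Pi.sub_apply]; ring

/-- THE `C¹` WIDTH TRANSFER: `‖a − ā‖_ν ≤ r` ⇒ `|dcosEval a θ − dcosEval ā θ| ≤ λ·r` — the factor the `C¹` consumers
(GGJ/Mercier averages, F3-WATCH-NOTE-2 §1) pay per `θ`-derivative. [cite: HungriaLessardMirelesJames2016, §2.1 (1.2)] -/
theorem abs_dcosEval_sub_le (hν : 1 ≤ ν) (hlam : IsDerivWeight ν lam) {a abar : ℕ → ℝ} {r : ℝ} (ha : Mem ν a)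
    (habar : Mem ν abar) (hr : wnorm ν (a - abar) ≤ r) (θ : ℝ) :
    |dcosEval a θ - dcosEval abar θ| ≤ lam * r := by
  rw [dcosEval_sub hlam ha habar]
  have hν0 : 0 < ν := lt_of_lt_of_le zero_lt_one hν
  exact (abs_dcosEval_le hlam (ha.sub hν0.le habar) θ).trans
    (mul_le_mul_of_nonneg_left hr (hlam.nonneg hν0))

end ThetaDerivative

/-! ## §3 The second `θ`-derivative (`C²`) dictionary: `d/dθ dcosEval a = ddcosEval a`, `|ddcosEval a| ≤ λ₂‖a‖_ν` whenever
`k² ≤ λ₂ν^k`, and the rational finite test for `λ₂` -/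

section ThetaSecondDerivative

variable {ν lam2 : ℝ}

/-- The termwise second `θ`-derivative of a cosine series: `ddcosEval a x = Σ' −k²·a_k·cos(kx)`. [folklore] -/
def ddcosEval (a : ℕ → ℝ) (x : ℝ) : ℝ := ∑' k : ℕ, -((k : ℝ) ^ 2 * a k) * Real.cos (k * x)

/-- A DECAY CONSTANT for two `θ`-derivatives at weight `ν`: `k² ≤ λ₂·ν^k` for every mode `k` (the value dictionary's
`C²` factor `max_k k²ν^{−k}`; certnum F2-ROUTE-A §0). [cite: HungriaLessardMirelesJames2016, §2.1 (1.2)] -/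
def IsDeriv2Weight (ν lam2 : ℝ) : Prop := ∀ k : ℕ, (k : ℝ) ^ 2 ≤ lam2 * ν ^ k

/-- RATIONAL FINITE TEST for the `C²` decay constant: for `ν > 1`, if `(N+1)² ≤ ν·N²` (so `(1 + 1/k)² ≤ ν` for all
`k ≥ N`) and `k² ≤ λ₂ν^k` for the finitely many `k ≤ N`, then `k² ≤ λ₂ν^k` for all `k`. [folklore] -/
theorem isDeriv2Weight_of_finite (hν : 1 < ν) {N : ℕ} (hN : ((N : ℝ) + 1) ^ 2 ≤ ν * (N : ℝ) ^ 2)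
    (hfin : ∀ k ≤ N, (k : ℝ) ^ 2 ≤ lam2 * ν ^ k) : IsDeriv2Weight ν lam2 := by
  intro k
  induction k with
  | zero => exact hfin 0 (Nat.zero_le _)
  | succ k ih =>
    by_cases hk : k + 1 ≤ N
    · exact hfin (k + 1) hk
    · have hkN : (N : ℝ) ≤ k := by exact_mod_cast (by omega : N ≤ k)
      have hν0 : 0 < ν := lt_trans zero_lt_one hν
      have hN0 : (0 : ℝ) ≤ N := Nat.cast_nonneg N
      have hk0 : (0 : ℝ) ≤ k := Nat.cast_nonneg k
      -- ((k+1) N)² ≤ ((N+1) k)²  from  (k+1)N ≤ (N+1)k  ⇔  N ≤ k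
      have hlin : ((k : ℝ) + 1) * N ≤ ((N : ℝ) + 1) * k := by nlinarith
      have hsq : (((k : ℝ) + 1) * N) ^ 2 ≤ (((N : ℝ) + 1) * k) ^ 2 :=
        pow_le_pow_left₀ (by positivity) hlin 2
      -- hence (k+1)² N² ≤ ν N² k², and N ≥ 1 here (k+1 > N ≥ 0 with N ≤ k; if N = 0 then hN gives 1 ≤ 0, absurd)
      have hN1 : (1 : ℝ) ≤ N := by
        by_contra hlt
        have hN0' : (N : ℝ) = 0 := by
          have : N = 0 := by
            by_contra hne
            exact hlt (by exact_mod_cast Nat.one_le_iff_ne_zero.2 hne)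
          simp [this]
        rw [hN0'] at hN; norm_num at hN
      have h1 : ((k : ℝ) + 1) ^ 2 ≤ ν * (k : ℝ) ^ 2 := by
        have hA : ((k : ℝ) + 1) ^ 2 * (N : ℝ) ^ 2 ≤ ν * (N : ℝ) ^ 2 * (k : ℝ) ^ 2 := by nlinarith
        have hNpos : (0 : ℝ) < (N : ℝ) ^ 2 := by positivity
        nlinarith
      have h2 : ν * (k : ℝ) ^ 2 ≤ ν * (lam2 * ν ^ k) := mul_le_mul_of_nonneg_left ih hν0.le
      calc ((k + 1 : ℕ) : ℝ) ^ 2 = ((k : ℝ) + 1) ^ 2 := by push_cast; ring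
        _ ≤ ν * (lam2 * ν ^ k) := h1.trans h2
        _ = lam2 * ν ^ (k + 1) := by ring

/-- A `C²` decay constant is nonnegative. [folklore] -/
theorem IsDeriv2Weight.nonneg (hν : 0 < ν) (h : IsDeriv2Weight ν lam2) : 0 ≤ lam2 := by
  have h1 := h 1
  simp only [Nat.cast_one, one_pow, pow_one] at h1
  nlinarith

/-- A `C²` decay constant is also a `C¹` decay constant (`k ≤ k²` on `ℕ`). [folklore] -/
theorem IsDeriv2Weight.isDerivWeight (h : IsDeriv2Weight ν lam2) : IsDerivWeight ν lam2 := by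
  intro k
  have hk : (k : ℝ) ≤ (k : ℝ) ^ 2 := by
    rcases Nat.eq_zero_or_pos k with h0 | hpos
    · simp [h0]
    · have h1 : (1 : ℝ) ≤ k := by exact_mod_cast hpos
      nlinarith
  exact hk.trans (h k)

/-- Termwise differentiability of the first derivative: with a `C²` decay constant, `θ ↦ dcosEval a θ` has derivative
`ddcosEval a θ` everywhere. [folklore] -/
theorem hasDerivAt_dcosEval (hlam2 : IsDeriv2Weight ν lam2) {a : ℕ → ℝ} (ha : Mem ν a) (x : ℝ) :
    HasDerivAt (dcosEval a) (ddcosEval a x) x := by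
  have hu : Summable fun k => lam2 * (|a k| * ν ^ k) := ha.mul_left lam2
  have hg : ∀ (k : ℕ) (y : ℝ),
      HasDerivAt (fun y => -((k : ℝ) * a k) * Real.sin (k * y)) (-((k : ℝ) ^ 2 * a k) * Real.cos (k * y)) y := by
    intro k y
    have h1 : HasDerivAt (fun y : ℝ => (k : ℝ) * y) (k : ℝ) y := by
      simpa using (hasDerivAt_id y).const_mul (k : ℝ)
    have h2 := (Real.hasDerivAt_sin ((k : ℝ) * y)).comp y h1
    have h3 := h2.const_mul (-((k : ℝ) * a k))
    have e : -((k : ℝ) * a k) * (Real.cos ((k : ℝ) * y) * (k : ℝ)) = -((k : ℝ) ^ 2 * a k) * Real.cos (k * y) := by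
      ring
    rw [← e]
    exact h3
  have hg' : ∀ (k : ℕ) (y : ℝ), ‖-((k : ℝ) ^ 2 * a k) * Real.cos (k * y)‖ ≤ lam2 * (|a k| * ν ^ k) := by
    intro k y
    rw [Real.norm_eq_abs, abs_mul, abs_neg, abs_mul, abs_pow, Nat.abs_cast]
    have hc := Real.abs_cos_le_one ((k : ℝ) * y)
    have hk := hlam2 k
    calc (k : ℝ) ^ 2 * |a k| * |Real.cos (k * y)| ≤ (k : ℝ) ^ 2 * |a k| * 1 := by
          exact mul_le_mul_of_nonneg_left hc (by positivity)
      _ ≤ lam2 * ν ^ k * |a k| * 1 := by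
          exact mul_le_mul_of_nonneg_right (mul_le_mul_of_nonneg_right hk (abs_nonneg _)) zero_le_one
      _ = lam2 * (|a k| * ν ^ k) := by ring
  have hlam : IsDerivWeight ν lam2 := hlam2.isDerivWeight
  have hg0 : Summable fun k : ℕ => -((k : ℝ) * a k) * Real.sin (k * x) := by
    refine Summable.of_norm_bounded (ha.mul_left lam2) fun k => ?_
    rw [Real.norm_eq_abs, abs_mul, abs_neg, abs_mul, Nat.abs_cast]
    have hs := Real.abs_sin_le_one ((k : ℝ) * x)
    have hk := hlam k
    calc (k : ℝ) * |a k| * |Real.sin (k * x)| ≤ (k : ℝ) * |a k| * 1 := by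
          exact mul_le_mul_of_nonneg_left hs (by positivity)
      _ ≤ lam2 * ν ^ k * |a k| * 1 := by
          exact mul_le_mul_of_nonneg_right (mul_le_mul_of_nonneg_right hk (abs_nonneg _)) zero_le_one
      _ = lam2 * (|a k| * ν ^ k) := by ring
  have h := hasDerivAt_tsum hu hg hg' hg0 x
  have e1 : dcosEval a = fun z => ∑' n : ℕ, -((n : ℝ) * a n) * Real.sin (n * z) := rfl
  have e2 : ddcosEval a x = ∑' n : ℕ, -((n : ℝ) ^ 2 * a n) * Real.cos (n * x) := rfl
  rw [e1, e2]
  exact h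

/-- THE `C²` DICTIONARY: `|ddcosEval a θ| ≤ λ₂‖a‖_ν`. [cite: HungriaLessardMirelesJames2016, §2.1 (1.2)] -/
theorem abs_ddcosEval_le (hlam2 : IsDeriv2Weight ν lam2) {a : ℕ → ℝ} (ha : Mem ν a) (x : ℝ) :
    |ddcosEval a x| ≤ lam2 * wnorm ν a := by
  have hbd : ∀ k : ℕ, ‖-((k : ℝ) ^ 2 * a k) * Real.cos (k * x)‖ ≤ lam2 * (|a k| * ν ^ k) := by
    intro k
    rw [Real.norm_eq_abs, abs_mul, abs_neg, abs_mul, abs_pow, Nat.abs_cast]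
    have hc := Real.abs_cos_le_one ((k : ℝ) * x)
    have hk := hlam2 k
    calc (k : ℝ) ^ 2 * |a k| * |Real.cos (k * x)| ≤ (k : ℝ) ^ 2 * |a k| * 1 := by
          exact mul_le_mul_of_nonneg_left hc (by positivity)
      _ ≤ lam2 * ν ^ k * |a k| * 1 := by
          exact mul_le_mul_of_nonneg_right (mul_le_mul_of_nonneg_right hk (abs_nonneg _)) zero_le_one
      _ = lam2 * (|a k| * ν ^ k) := by ring
  have hsum : HasSum (fun k => lam2 * (|a k| * ν ^ k)) (lam2 * wnorm ν a) := (ha.hasSum).mul_left lam2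
  have h := tsum_of_norm_bounded hsum hbd
  rw [Real.norm_eq_abs] at h
  have e2 : ddcosEval a x = ∑' n : ℕ, -((n : ℝ) ^ 2 * a n) * Real.cos (n * x) := rfl
  rw [e2]
  exact h

/-- `ddcosEval` is additive on `ℓ¹_ν` (given a `C²` decay constant). [folklore] -/
theorem ddcosEval_sub (hlam2 : IsDeriv2Weight ν lam2) {a b : ℕ → ℝ} (ha : Mem ν a) (hb : Mem ν b) (x : ℝ) :
    ddcosEval a x - ddcosEval b x = ddcosEval (a - b) x := by
  have bound : ∀ (c : ℕ → ℝ), Mem ν c → Summable fun k : ℕ => -((k : ℝ) ^ 2 * c k) * Real.cos (k * x) := by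
    intro c hc
    refine Summable.of_norm_bounded (hc.mul_left lam2) fun k => ?_
    rw [Real.norm_eq_abs, abs_mul, abs_neg, abs_mul, abs_pow, Nat.abs_cast]
    have hcs := Real.abs_cos_le_one ((k : ℝ) * x)
    have hk := hlam2 k
    calc (k : ℝ) ^ 2 * |c k| * |Real.cos (k * x)| ≤ (k : ℝ) ^ 2 * |c k| * 1 := by
          exact mul_le_mul_of_nonneg_left hcs (by positivity)
      _ ≤ lam2 * ν ^ k * |c k| * 1 := by
          exact mul_le_mul_of_nonneg_right (mul_le_mul_of_nonneg_right hk (abs_nonneg _)) zero_le_one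
      _ = lam2 * (|c k| * ν ^ k) := by ring
  unfold ddcosEval
  rw [← (bound a ha).tsum_sub (bound b hb)]
  congr 1; funext k; simp only [Pi.sub_apply]; ring

/-- THE `C²` WIDTH TRANSFER: `‖a − ā‖_ν ≤ r` ⇒ `|ddcosEval a θ − ddcosEval ā θ| ≤ λ₂·r` — the factor the `C²` consumers
(curvature / local shear / ballooning coefficients, F3-WATCH-NOTE-2 §1 row 5) pay. [cite: HungriaLessardMirelesJames2016, §2.1 (1.2)] -/
theorem abs_ddcosEval_sub_le (hν : 1 ≤ ν) (hlam2 : IsDeriv2Weight ν lam2) {a abar : ℕ → ℝ} {r : ℝ} (ha : Mem ν a)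
    (habar : Mem ν abar) (hr : wnorm ν (a - abar) ≤ r) (θ : ℝ) :
    |ddcosEval a θ - ddcosEval abar θ| ≤ lam2 * r := by
  rw [ddcosEval_sub hlam2 ha habar]
  have hν0 : 0 < ν := lt_of_lt_of_le zero_lt_one hν
  exact (abs_ddcosEval_le hlam2 (ha.sub hν0.le habar) θ).trans
    (mul_le_mul_of_nonneg_left hr (hlam2.nonneg hν0))

end ThetaSecondDerivative

end RouteA

end Summit.Ventures.FusionMHD.Models

end
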